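import Summits.CriticalPhenomena.PercolationContinuityZ3.Theorems.Transplant.SiteKNSeeds
import Literature.Probability.Percolation.KozmaNitzanPinning
import HarnessLib

/-!
# SITE Kozma–Nitzan §4, Lemma 10 — part 5: Step V, site Conjecture 3 in the pinned vertex weightings
# (site twin of `L/KozmaNitzanTargetLemma.lean` ll. 1662–1915)

builds on p205010 (kernel theorem, internal audit signed; external expert review pending).
Lane `prim-bschramm`, class C1a (site percolation on `ℤ³`), seat p1 gen 3, block (α) of the SITE same-`p` witness
(`SiteSameP.SiteSamePWitnessZd`, socket p217536).  Helper file (`--supports stmt-CriticalPhenomena-4575`).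

**`SLHyp.stepV_in`** — KN pp. 21–22 in site form: the averaged estimate (26) ⟹ `Σ_ξ p_ξ φ_ξ > (1−3δ)²`, the set `W` of
good vertex patterns `ξ` on the shell `S`, the site gluing hypothesis in each pinned weighting `pinW w ↑S ξ`, `ξ ∈ W`,
and the final summation — with the relay set `A_ξ := {u ∈ S : P(u ↔^{site} T inside Rg | ξ) > 1 − δ}`.  Inputs: a level
`j` with many contacts w.h.p. (Step II), the seed bound (Step III), the face estimate of `stepIV_in` for every potential
contact, and the site gluing hypothesis (`SiteKNTransfer.siteGluing_avoiding`) for finitely supported vertex weightings.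
One SITE point: the site seed does not contain the face `U(P)` (which lies in the pinned shell), so "`o ↔ A_ξ` on `F_x`"
holds through a good vertex `u ∈ U(x) ∩ A_ξ` only because a good vertex is pinned OPEN (`u ∈ ξ`, else its conditional
connection probability would vanish) — an almost sure statement under the pinned law, which is all (26) needs.
[cite: KozmaNitzan2024, §4 pp. 21–22 (Step V)]
-/

noncomputable section

namespace Summit.CriticalPhenomena.PercolationContinuityZ3.Theorems.Transplant

namespace SiteKN

open MeasureTheory ProbabilityTheory
open Literature.Probability.Percolation Literature.Probability.LatticeModels
open Literature.Probability.Percolation.KozmaNitzan (LData)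
open SiteTransplant (siteConn mem_siteConn)

variable {d : ℕ} {L : LData d}

namespace SLHyp

variable {w : Site d → unitInterval} {p : unitInterval} {D : Finset (Site d)} {R : ℕ}
variable (hL : SLHyp L w p D R)
include hL

/-- Pinning vertices of `Sfin` keeps the weighting supported in `Sfin`. [folklore] -/
theorem finSupp_pinW {S : Finset (Site d)} (hS : S ⊆ L.Sfin) (ξ : Set (Site d)) :
    SiteFinSupp (pinW w (↑S : Set (Site d)) ξ) L.Sfin := by
  refine ⟨fun v hv => ?_⟩
  rw [pinW_apply_of_not_mem w ξ (fun hvS => hv (hS (Finset.mem_coe.1 hvS))), hL.fin.zero v hv]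

open Classical in
/-- **Step V with region-internal relay reliability** (site form of KN pp. 21–22).
[cite: KozmaNitzan2024, §4 pp. 21–22 (Step V)] -/
theorem stepV_in [NeZero d] {Rg : Set (Site d)} {j M k : ℕ} (hj : j ≤ R + 1)
    (hwide : ∀ k, L.Lo j k + 2 * M + 2 ≤ L.Hi j k)
    {S T : Finset (Site d)} (hS : S ⊆ Finset.Icc (L.Lo j + 1) (L.Hi j - 1)) (hSD : S ⊆ D)
    {ε δ δc : ℝ} (hε : 0 < ε) (hε1 : ε ≤ 1) (hδ : 0 < δ) (hδc : δ ≤ δc)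
    (h3δ : 3 * δ ≤ 1) (h12 : 12 * δ ≤ ε * δc)
    (hII : 1 - 2 * δ < (prodBernoulli w).real (sFail L (LData.Ncont d M k) j)ᶜ)
    (hIII : (1 - (p : ℝ) ^ siteSeedBound d M) ^ k ≤ δ)
    (hUS : ∀ x ∈ outerBoundary (zdGraph d) (L.X j), L.ufaceX j M x ⊆ S)
    (hIV : ∀ x ∈ outerBoundary (zdGraph d) (L.X j),
      1 - 3 * δ ≤ (prodBernoulli w).real {ω | ∃ u ∈ L.ufaceX j M x,
        1 - δ < (prodBernoulli (pinW w (↑S : Set (Site d)) ω)).real (⋃ t ∈ T, siteConnIn (zdGraph d) Rg u t)})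
    (hC3 : ∀ (w' : Site d → unitInterval), SiteFinSupp w' L.Sfin → ∀ (A : Finset (Site d)), A ⊆ L.Sfin →
      1 - δc < (prodBernoulli w').real (⋃ a ∈ A, siteConn (zdGraph d) L.o a) →
      (∀ a ∈ A, 1 - δc < (prodBernoulli w').real (⋃ t ∈ T, siteConnIn (zdGraph d) Rg a t)) →
      1 - ε / 2 < (prodBernoulli w').real (⋃ t ∈ T, siteConn (zdGraph d) L.o t)) :
    1 - ε < (prodBernoulli w).real (⋃ t ∈ T, siteConn (zdGraph d) L.o t) := by
  set μ := prodBernoulli w with hμ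
  set OB := outerBoundary (zdGraph d) (L.X j) with hOB
  have hSfin : S ⊆ L.Sfin := hSD.trans hL.DS
  -- the good sets `A_ξ` and the quantities `φ_ξ`
  set Aof : Finset (Site d) → Finset (Site d) := fun P => S.filter fun u =>
    1 - δ < (prodBernoulli (pinW w (↑S : Set (Site d)) ↑P)).real (⋃ t ∈ T, siteConnIn (zdGraph d) Rg u t)
    with hAof
  set φ : Finset (Site d) → ℝ := fun P =>
    (prodBernoulli (pinW w ↑S ↑P)).real (⋃ a ∈ Aof P, siteConn (zdGraph d) L.o a) with hφ
  set cyl : Finset (Site d) → Set (SiteConfig (Site d)) := fun P => localCylinder ↑S ↑P with hcyl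
  -- good vertices are pinned open
  have hAof_mem : ∀ P, ∀ u ∈ Aof P, u ∈ P := by
    intro P u hu
    obtain ⟨huS, hgu⟩ := Finset.mem_filter.1 hu
    by_contra huP
    have h0 : pinW w (↑S : Set (Site d)) ↑P u = 0 :=
      pinW_apply_of_mem_of_not_mem w (Finset.mem_coe.2 huS) (fun h' => huP (Finset.mem_coe.1 h'))
    have hnull : (prodBernoulli (pinW w (↑S : Set (Site d)) ↑P)).real
        (⋃ t ∈ T, siteConnIn (zdGraph d) Rg u t) = 0 := by
      refine le_antisymm ?_ measureReal_nonneg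
      have hsub : (⋃ t ∈ T, siteConnIn (zdGraph d) Rg u t) ⊆ {ω : SiteConfig (Site d) | u ∈ ω} := by
        intro ω hω
        simp only [Set.mem_iUnion, exists_prop] at hω
        obtain ⟨t, -, hut⟩ := hω
        exact hut.1
      refine (measureReal_mono hsub (measure_ne_top _ _)).trans ?_
      rw [prodBernoulli_real_setOf_mem, h0]; simp
    rw [hnull] at hgu
    linarith
  have hAof_ae : ∀ P, ∀ᵐ ω ∂prodBernoulli (pinW w (↑S : Set (Site d)) ↑P), ∀ u ∈ Aof P, u ∈ ω := by
    intro P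
    have : ∀ u ∈ Aof P, ∀ᵐ ω ∂prodBernoulli (pinW w (↑S : Set (Site d)) ↑P), u ∈ ω := fun u hu =>
      prodBernoulli_ae_mem_of_eq_one _ (pinW_apply_of_mem_of_mem w
        (Finset.mem_coe.2 (Finset.mem_filter.1 hu).1) (Finset.mem_coe.2 (hAof_mem P u hu)))
    exact (ae_ball_iff (Aof P).countable_toSet).2 this
  -- `μ(𝒢) > 1 - 3δ`
  have hG : 1 - 3 * δ < μ.real (sGev L j M k) := by
    have hmG : MeasurableSet (sGev L j M k) := measurableSet_sGev j M k
    have h1 := hL.real_manyContacts_diff_sGev_le (j := j) (M := M) (k := k) hj hwide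
    have h2 : μ.real (sFail L (LData.Ncont d M k) j)ᶜ ≤
        μ.real ((sFail L (LData.Ncont d M k) j)ᶜ \ sGev L j M k) + μ.real (sGev L j M k) := by
      rw [← measureReal_inter_add_sdiff (s := (sFail L (LData.Ncont d M k) j)ᶜ) hmG, add_comm]
      exact add_le_add le_rfl (measureReal_mono Set.inter_subset_right)
    linarith
  -- Claim D: `Σ_P μ(cyl P) φ(P) ≥ (1 - 3δ) μ(𝒢)`
  have hGood_det : ∀ x, DeterminedBy {ω | ∃ u ∈ L.ufaceX j M x,
      1 - δ < (prodBernoulli (pinW w (↑S : Set (Site d)) ω)).real (⋃ t ∈ T, siteConnIn (zdGraph d) Rg u t)} ↑S := by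
    intro x
    rw [determinedBy_iff]
    intro ω ω' hω
    simp only [Set.mem_setOf_eq]
    have hag : ∀ v ∈ (↑S : Set (Site d)), v ∈ ω ↔ v ∈ ω' := by
      intro v hv
      have := Set.ext_iff.1 hω v
      simp only [Set.mem_inter_iff] at this
      exact ⟨fun h' => (this.1 ⟨h', hv⟩).1, fun h' => (this.2 ⟨h', hv⟩).1⟩
    refine exists_congr fun u => and_congr_right fun _ => ?_
    rw [pinW_congr w hag]
  have hFx_pin : ∀ P, ∀ x ∈ OB, (prodBernoulli (pinW w ↑S ↑P)).real (sFx L j M k x) = μ.real (sFx L j M k x) := by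
    intro P x hx
    rw [hμ]
    exact (prodBernoulli_real_eq_of_determinedBy w _ (F := (↑S : Set (Site d))ᶜ)
      (fun v hv => (pinW_apply_of_not_mem w ↑P hv).symm) (determinedBy_sFx hwide hS hx) (measurableSet_sFx hx)).symm
  have hφ_ge : ∀ P, P ⊆ S →
      ∑ x ∈ OB.filter (fun x => ∃ u ∈ L.ufaceX j M x, u ∈ Aof P), μ.real (sFx L j M k x) ≤ φ P := by
    intro P hP
    set ν := prodBernoulli (pinW w (↑S : Set (Site d)) ↑P) with hν
    have hsub : (⋃ x ∈ OB.filter (fun x => ∃ u ∈ L.ufaceX j M x, u ∈ Aof P), sFx L j M k x) ∩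
        {ω | ∀ u ∈ Aof P, u ∈ ω} ⊆ ⋃ a ∈ Aof P, siteConn (zdGraph d) L.o a := by
      rintro ω ⟨hω, hopen⟩
      simp only [Set.mem_iUnion, exists_prop, Finset.mem_filter] at hω ⊢
      obtain ⟨x, ⟨hxO, u, hu, huA⟩, hFx⟩ := hω
      exact ⟨u, huA, siteConn_of_mem_sOSeed hwide hxO (sFx_subset_sOSeed x hFx) hu (hopen u huA)⟩
    have hae : ν.real (⋃ x ∈ OB.filter (fun x => ∃ u ∈ L.ufaceX j M x, u ∈ Aof P), sFx L j M k x) =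
        ν.real ((⋃ x ∈ OB.filter (fun x => ∃ u ∈ L.ufaceX j M x, u ∈ Aof P), sFx L j M k x) ∩
          {ω | ∀ u ∈ Aof P, u ∈ ω}) := by
      refine measureReal_congr ?_
      filter_upwards [hAof_ae P] with ω hω
      exact propext ⟨fun h' => ⟨h', hω⟩, fun h' => h'.1⟩
    calc _ = ∑ x ∈ OB.filter (fun x => ∃ u ∈ L.ufaceX j M x, u ∈ Aof P), ν.real (sFx L j M k x) :=
          Finset.sum_congr rfl fun x hx => (hFx_pin P x (Finset.mem_filter.1 hx).1).symm
      _ = ν.real (⋃ x ∈ OB.filter (fun x => ∃ u ∈ L.ufaceX j M x, u ∈ Aof P), sFx L j M k x) := by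
          rw [measureReal_biUnion_finset]
          · intro x hx x' hx' hne
            exact sFx_disjoint hne (Finset.mem_filter.1 hx').1 (Finset.mem_filter.1 hx).1
          · intro x hx; exact measurableSet_sFx (Finset.mem_filter.1 hx).1
      _ ≤ φ P := by rw [hae]; exact measureReal_mono hsub (measure_ne_top _ _)
  have hD : (1 - 3 * δ) * μ.real (sGev L j M k) ≤ ∑ P ∈ S.powerset, μ.real (cyl P) * φ P := by
    have hGx : ∀ x ∈ OB, μ.real {ω | ∃ u ∈ L.ufaceX j M x,
        1 - δ < (prodBernoulli (pinW w (↑S : Set (Site d)) ω)).real (⋃ t ∈ T, siteConnIn (zdGraph d) Rg u t)} =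
        ∑ P ∈ S.powerset.filter (fun P => ∃ u ∈ L.ufaceX j M x, u ∈ Aof P), μ.real (cyl P) := by
      intro x hx
      rw [hμ, prodBernoulli_real_eq_sum_localCylinder w S (hGood_det x)]
      refine Finset.sum_congr ?_ fun P _ => rfl
      ext P
      simp only [Finset.mem_filter, Finset.mem_powerset, Set.mem_setOf_eq, hAof, and_congr_right_iff]
      intro _
      constructor
      · rintro ⟨u, hu, hg⟩; exact ⟨u, hu, hUS x hx hu, hg⟩
      · rintro ⟨u, hu, -, hg⟩; exact ⟨u, hu, hg⟩
    calc (1 - 3 * δ) * μ.real (sGev L j M k)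
        = ∑ x ∈ OB, (1 - 3 * δ) * μ.real (sFx L j M k x) := by
          rw [← biUnion_sFx_eq_sGev, measureReal_biUnion_finset, Finset.mul_sum]
          · intro x hx x' hx' hne; exact sFx_disjoint hne hx' hx
          · intro x hx; exact measurableSet_sFx hx
      _ ≤ ∑ x ∈ OB, μ.real {ω | ∃ u ∈ L.ufaceX j M x,
            1 - δ < (prodBernoulli (pinW w (↑S : Set (Site d)) ω)).real (⋃ t ∈ T, siteConnIn (zdGraph d) Rg u t)} *
            μ.real (sFx L j M k x) :=
          Finset.sum_le_sum fun x hx => mul_le_mul_of_nonneg_right (hIV x hx) measureReal_nonneg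
      _ = ∑ x ∈ OB, ∑ P ∈ S.powerset.filter (fun P => ∃ u ∈ L.ufaceX j M x, u ∈ Aof P),
            μ.real (cyl P) * μ.real (sFx L j M k x) := by
          refine Finset.sum_congr rfl fun x hx => ?_
          rw [hGx x hx, Finset.sum_mul]
      _ = ∑ P ∈ S.powerset, ∑ x ∈ OB.filter (fun x => ∃ u ∈ L.ufaceX j M x, u ∈ Aof P),
            μ.real (cyl P) * μ.real (sFx L j M k x) := by
          rw [Finset.sum_comm' (t' := S.powerset)
            (s' := fun P => OB.filter (fun x => ∃ u ∈ L.ufaceX j M x, u ∈ Aof P))]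
          intro x P
          simp only [Finset.mem_filter, Finset.mem_powerset]
          tauto
      _ = ∑ P ∈ S.powerset, μ.real (cyl P) *
            ∑ x ∈ OB.filter (fun x => ∃ u ∈ L.ufaceX j M x, u ∈ Aof P), μ.real (sFx L j M k x) := by
          refine Finset.sum_congr rfl fun P _ => ?_
          rw [Finset.mul_sum]
      _ ≤ ∑ P ∈ S.powerset, μ.real (cyl P) * φ P :=
          Finset.sum_le_sum fun P hP => mul_le_mul_of_nonneg_left (hφ_ge P (Finset.mem_powerset.1 hP)) measureReal_nonneg
  -- total mass of the cylinders is `1`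
  have hcyl_sum : ∑ P ∈ S.powerset, μ.real (cyl P) = 1 := by
    have := prodBernoulli_real_eq_sum_localCylinder w S (determinedBy_univ (↑S : Set (Site d)))
    rw [probReal_univ] at this
    rw [hμ, this]
    refine (Finset.sum_congr ?_ fun P _ => rfl)
    ext P; simp
  -- Claim E: the bad patterns have mass `≤ ε/2`
  set Bad := S.powerset.filter (fun P => φ P ≤ 1 - δc) with hBad
  have hφ_le : ∀ P, φ P ≤ 1 := fun P => measureReal_le_one
  have hE : ∑ P ∈ Bad, μ.real (cyl P) ≤ ε / 2 := by
    have hδc0 : 0 < δc := hδ.trans_le hδc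
    have h1 : δc * ∑ P ∈ Bad, μ.real (cyl P) ≤ ∑ P ∈ S.powerset, μ.real (cyl P) * (1 - φ P) := by
      rw [Finset.mul_sum]
      calc ∑ P ∈ Bad, δc * μ.real (cyl P) ≤ ∑ P ∈ Bad, μ.real (cyl P) * (1 - φ P) :=
            Finset.sum_le_sum fun P hP => by
              rw [mul_comm]
              exact mul_le_mul_of_nonneg_left (by have := (Finset.mem_filter.1 hP).2; linarith) measureReal_nonneg
        _ ≤ ∑ P ∈ S.powerset, μ.real (cyl P) * (1 - φ P) :=
            Finset.sum_le_sum_of_subset_of_nonneg (Finset.filter_subset _ _) fun P _ _ =>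
              mul_nonneg measureReal_nonneg (by linarith [hφ_le P])
    have h2 : ∑ P ∈ S.powerset, μ.real (cyl P) * (1 - φ P) =
        1 - ∑ P ∈ S.powerset, μ.real (cyl P) * φ P := by
      simp only [mul_sub, mul_one, Finset.sum_sub_distrib, hcyl_sum]
    have h3 : 1 - ∑ P ∈ S.powerset, μ.real (cyl P) * φ P < 6 * δ := by
      have : (1 - 3 * δ) * (1 - 3 * δ) < (1 - 3 * δ) * μ.real (sGev L j M k) ∨ 1 - 3 * δ = 0 := by
        rcases eq_or_lt_of_le (sub_nonneg.2 h3δ) with h0 | h0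
        · exact Or.inr h0.symm
        · exact Or.inl (mul_lt_mul_of_pos_left hG h0)
      rcases this with h4 | h4
      · nlinarith
      · have : ∑ P ∈ S.powerset, μ.real (cyl P) * φ P ≥ 0 :=
          Finset.sum_nonneg fun P _ => mul_nonneg measureReal_nonneg measureReal_nonneg
        nlinarith
    have h4 : δc * ∑ P ∈ Bad, μ.real (cyl P) ≤ 6 * δ := by linarith
    have h5 : δc * ∑ P ∈ Bad, μ.real (cyl P) ≤ δc * (ε / 2) := by nlinarith
    exact le_of_mul_le_mul_left h5 hδc0
  -- Claim F: on good patterns the gluing hypothesis applies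
  have hF : ∀ P ∈ S.powerset, P ∉ Bad →
      1 - ε / 2 < (prodBernoulli (pinW w ↑S ↑P)).real (⋃ t ∈ T, siteConn (zdGraph d) L.o t) := by
    intro P hP hPB
    have hgood : 1 - δc < φ P := by
      by_contra hle; exact hPB (Finset.mem_filter.2 ⟨hP, not_lt.1 hle⟩)
    refine hC3 _ (hL.finSupp_pinW hSfin ↑P) (Aof P) ((Finset.filter_subset _ _).trans hSfin) hgood fun a ha => ?_
    have hga := (Finset.mem_filter.1 ha).2
    linarith
  -- conclusion: total probability over the patterns
  have hmT : MeasurableSet (⋃ t ∈ T, siteConn (zdGraph d) L.o t : Set (SiteConfig (Site d))) :=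
    Finset.measurableSet_biUnion _ fun t _ => measurableSet_siteConn _ _ _
  have htot := prodBernoulli_real_inter_eq_sum_pinW w S hmT (determinedBy_univ (↑S : Set (Site d)))
  rw [Set.inter_univ] at htot
  simp only [Set.mem_univ, Finset.filter_true] at htot
  rw [hμ] at hE hcyl_sum
  rw [htot]
  calc 1 - ε < (1 - ε / 2) * (1 - ε / 2) := by nlinarith
    _ ≤ (1 - ε / 2) * ∑ P ∈ S.powerset \ Bad, (prodBernoulli w).real (cyl P) := by
        have hnonneg : (0 : ℝ) ≤ 1 - ε / 2 := by linarith
        have : ∑ P ∈ S.powerset \ Bad, (prodBernoulli w).real (cyl P) =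
            1 - ∑ P ∈ Bad, (prodBernoulli w).real (cyl P) := by
          have hBsub : Bad ⊆ S.powerset := by rw [hBad]; exact Finset.filter_subset _ _
          rw [← hcyl_sum, ← Finset.sum_sdiff hBsub]; ring
        rw [this]
        exact mul_le_mul_of_nonneg_left (by linarith) hnonneg
    _ = ∑ P ∈ S.powerset \ Bad, (prodBernoulli w).real (cyl P) * (1 - ε / 2) := by
        rw [Finset.mul_sum]; refine Finset.sum_congr rfl fun P _ => mul_comm _ _
    _ ≤ ∑ P ∈ S.powerset \ Bad, (prodBernoulli w).real (cyl P) *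
          (prodBernoulli (pinW w ↑S ↑P)).real (⋃ t ∈ T, siteConn (zdGraph d) L.o t) :=
        Finset.sum_le_sum fun P hP => by
          obtain ⟨hP1, hP2⟩ := Finset.mem_sdiff.1 hP
          exact mul_le_mul_of_nonneg_left (hF P hP1 hP2).le measureReal_nonneg
    _ ≤ ∑ P ∈ S.powerset, (prodBernoulli w).real (cyl P) *
          (prodBernoulli (pinW w ↑S ↑P)).real (⋃ t ∈ T, siteConn (zdGraph d) L.o t) :=
        Finset.sum_le_sum_of_subset_of_nonneg Finset.sdiff_subset fun P _ _ =>
          mul_nonneg measureReal_nonneg measureReal_nonneg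

end SLHyp

end SiteKN

end Summit.CriticalPhenomena.PercolationContinuityZ3.Theorems.Transplant

end
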